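import Summits.QuantumFields.BalabanUV.Beta.FP.TowerFRowsTrueWeight
import Summits.QuantumFields.BalabanUV.Beta.FP.DressedEntryWardInvarianceDual

/-!
# `BalabanUV.Beta.FP.TowerFRowsTrueWeightDual` — road «FP», binder row D1, ROUTE T, the (H5-F) option (3a) IN THE DUAL LETTERS (an2 g85 W-11 FINDING AN2-85-1; road g63 A-1∕A-2):
# **THE END CONSUMER's F-ROWS `hF₁ ∕ htr` AT THE RENORMALISED TRUE WEIGHT `(α j)⁻¹ • wF`, FROM `hgaugeᴰ` (∀ j) AND `hW𝒯` (j ≥ 1) ONLY — NO GAUGE POTENTIAL `ζ`, NO `hζ`**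
# (the dual twin of road g62 `TowerFRowsTrueWeight`; every other letter BY NAME: an2 PART 96∕97, road g61∕g62∕g63)

WHY (journal an2 W-11 l.69234 (A)+(B), S-7 l.69236 (PART 98 `TowerFWeightCoclosedPairing` p758355 ∕ PART 99 `TowerFWeightGaugeDropout`); road A-1 l.69235, A-2 l.69237).  Road g62's
`TowerFRowsTrueWeight` closes the consumer's two F-rows from the PRIMAL gauge letter `hgauge j : (α j)⁻¹•wF j − wStep Lc (j+1) = ` a backward fine gradient of a displayed
potential `ζ j a`, plus `hζ` and `hW𝒯`.  Road g63 `DressedEntryWardInvarianceDual` shows the potential is idle: `hWT` needs only that the defect, read in the fine POSITION variable,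
be orthogonal to every bounded co-closed covector (`hgaugeᴰ`), and the row's PART 98∕99 compute exactly that pairing for `wFRec` BY NAME up to one column letter (K1ᶜ).  THIS FILE
is the consumer-side composition in the dual letters: the same two row TEXTS (`…PairingSummable` L.361 `hF₁`, L.364 `htr`) at the same lambda weight, with `(ζ, hζ, hgauge)` REPLACED by
`hgaugeᴰ` — so the END's displayed F-residue under (3a) becomes {`hgaugeᴰ j` ∀ j, `hW𝒯 j` j ≥ 1} (and, with PART 98∕99, {(K1ᶜ) ∀ j, `hW𝒯 j` j ≥ 1} — the row's call, nothing of it here).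
Chain: road g61 `htr_rec_w ∕ hF₁_rec_w` (rows for ANY exponentially localised weight, `hwloc := TowerFWeightRecLoc.hwloc_mul_wF`) ⟶ §1∕§2 below (dual twins of g62
`TowerFTransportWardRecord.htr_of_gauge_of_ward` ∕ `TowerFAnchorWardRecord.hF₁_of_anchor_of_gauge`: road g63 `dressedEntry_eq_of_dualGauge_of_wardTransversal` fed g62's
`absMoment₂_hessKer_AN ∕ indexSymmetric_hessKer_AN` (storeys ≥ 1) and `wardTransversal_flipK_TshotOf_JcComp_one ∕ indexSymmetric_TshotOf_JcComp_one ∕ absMoment₂_TshotOf_JcComp_one`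
(the anchor: BOTH table letters are tree theorems, FINDING FP-70 (b))); weight moments by PART 97 v1.3 `absMoment₂_mul_wF`.

WHAT ([folklore] composition BY NAME; no `def`, no `def … : Prop`, nothing cited, 0 sorry): §1 `dressedEntry_hessKer_AN_eq_of_dualGauge_of_ward`, **`htr_of_dualGauge_of_ward`** (storeys
`j ≥ 1`, any roots `R`, abstract left sides `H j`); §2 `hWT_anchor_of_dualGauge`, **`hF₁_of_anchor_of_dualGauge`** (storey 0, abstract `H`); §3 **`htr_trueWeight_dual`**,
**`hF₁_trueWeight_dual`** — g62's two conclusions VERBATIM, hypotheses `hgaugeᴰ : ∀ j ≥ 1 (resp. j = 0), ∀ a (ψ : Form1 4 ℝ) (M : ℝ), (∀ c x, |ψ c x| ≤ M) → codiff₁ ψ = 0 →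
lip1 ψ (fun c x => (α j)⁻¹ * wF Lc Q ℓ sn j c a (−x) − wStep Lc (j+1) c a (−x)) = 0`, `hW𝒯` (j ≥ 1), the brick bound `hℓb`, `uF j ≠ 0`, and (anchor) M‴'s scalars.
WHAT THIS IS NOT: not `hgaugeᴰ`, not `hW𝒯` (DISPLAYED; by value A2-HQF0 ∕ TEL2 C10; by name the row's PART 98∕99 up to (K1ᶜ)); not the END (xread); nothing of Bałaban's asserted,
valued or discharged; 0 estimates; 0∕4 row-D1 binders (hW, hR, D1Tel, D1Rep); NOT (C1), NOT (T-ID), NOT D1, NEVER «G-an2-4 closed», NOT BetaPertH, NOT continuum, NOT Clay.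

HONEST DEPENDENCY (page 1, mandatory): continuum YM on T⁴ ⇐ BetaPertH ∧ nine spine estimates (0/9 proved); BetaPertH ⇐ (D1) ∧ (D4) ∧ CAP+tail;
G-an2-4 gates asym, D1 and NE2/3/4.  HONEST FRAMING (cell contract, verbatim): «discharging `BetaPertH` makes Bałaban's UV stability UNCONDITIONAL —
a real constructive-QFT result; it is NOT the continuum limit and NOT the Clay problem.»  ABSOLUTE RULE (cell charter, verbatim): «No internally-minted
statement may enter as a cited fact. Every hypothesis is either kernel-proved in this package or a verbatim quotation of a PUBLISHED theorem with page
reference. The manuscript(s) under audit are NOT citable for their own disputed steps — they are the thing under adjudication; programme-internal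
(2001/route/tribunal) claims are never citable.»  Road «FP» OWNER, b2b-balaban-beta-d1-p3 gen 63, 2026-08-30.  No existing file touched.
-/

noncomputable section

open scoped BigOperators

namespace Summit.QuantumFields.BalabanUV.Beta.FP.TowerFRowsTrueWeightDual

open Finset
open Literature.MathematicalPhysics.QuantumFieldTheory
open Literature.MathematicalPhysics.QuantumFieldTheory.Balaban1983to89
open Literature.MathematicalPhysics.QuantumFieldTheory.Balaban1983to89.Beta
open B12Sec2to5 (l1)
open AffineAveraging (Site Form1 codiff₁)
open KKTFluctuationEnergy (lip1)
open AveragingHessianKernels (Bond)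
open ExpKernelCalculus (MKer hessKer)
open DecimatedMomentSummable (AbsMoment₂)
open DressedMomentNormalisation (EKer dressedEntry)
open HessKerRate (scaleK)
open HessianTelescopingKKT (wStep absMoment₂_wStep)
open OneStepResolventKernel (Fib)
open OneStepKernelFamily (vertexOfK TshotOf flipK)
open PolarizationSign (WardTransversal IndexSymmetric)
open Summit.QuantumFields.BalabanUV.Beta.SymSecondOrderTablesAn1 (symTablesAn1S2)
open Summit.QuantumFields.BalabanUV.Beta.CombChartStepJets (GcombSh JsB12CombSh0)
open Summit.QuantumFields.BalabanUV.Beta.CompositeOneShotJetData (Roots Pins AN VN WN JcComp)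
open Summit.QuantumFields.BalabanUV.Beta.FP.TorusCompositeObjectsG (StepRows)
open Summit.QuantumFields.BalabanUV.Beta.FP.KernelStepDressing (dressV dressW)
open Summit.QuantumFields.BalabanUV.Beta.FP.TowerFWeightRecDefs (wF)
open Summit.QuantumFields.BalabanUV.Beta.FP.TowerFWeightRecLoc (hwloc_mul_wF absMoment₂_mul_wF)
open Summit.QuantumFields.BalabanUV.Beta.FP.TowerFTransportRowW (htr_rec_w)
open Summit.QuantumFields.BalabanUV.Beta.FP.TowerFAnchorRowW (hF₁_rec_w)
open Summit.QuantumFields.BalabanUV.Beta.FP.TowerFTransportWardRecord (absMoment₂_hessKer_AN)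
open Summit.QuantumFields.BalabanUV.Beta.FP.TowerNKernelIndexSymmetry (indexSymmetric_hessKer_AN)
open Summit.QuantumFields.BalabanUV.Beta.FP.TowerFAnchorWardRecord (wardTransversal_flipK_TshotOf_JcComp_one indexSymmetric_TshotOf_JcComp_one
  absMoment₂_TshotOf_JcComp_one)
open Summit.QuantumFields.BalabanUV.Beta.FP.DressedEntryWardInvarianceDual (dressedEntry_eq_of_dualGauge_of_wardTransversal)

/-! ## §1 Storeys `j ≥ 1`: one storey and the consumer's `htr` text, dual gauge letter (any roots) -/

section Transport

variable {Lc : ℕ} [NeZero Lc] (R : Roots Lc) (P : Pins)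

/-- [folklore] **`dressedEntry_hessKer_AN_eq_of_dualGauge_of_ward`** — at storey `j`, for a weight `w : EKer 4` whose defect to `wStep Lc (j+1)`, read in the fine position variable, is
orthogonal to every bounded co-closed covector (`hgaugeᴰ`), and under the printed Ward identity of the record's composite one-loop kernel (`hW𝒯`), the kernel is dressed identically by
`w` and by `wStep Lc (j+1)` (road g63 `dressedEntry_eq_of_dualGauge_of_wardTransversal`; index symmetry road g62 `indexSymmetric_hessKer_AN`; moments `absMoment₂_hessKer_AN`, lit `absMoment₂_wStep`). -/
theorem dressedEntry_hessKer_AN_eq_of_dualGauge_of_ward (j : ℕ) (w : EKer 4) (hw : ∀ κ l, AbsMoment₂ (w κ l))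
    (hgaugeD : ∀ (a : Fin 4) (ψ : Form1 4 ℝ) (M : ℝ), (∀ c x, |ψ c x| ≤ M) → codiff₁ ψ = 0 →
      lip1 ψ (fun c x => w c a (-x) - wStep Lc (j + 1) c a (-x)) = 0)
    (hW𝒯 : WardTransversal (flipK (hessKer (AN R j) (VN R P j) (WN R P j))))
    (y : Fin 4 → ℤ) (a b : Fin 4) :
    dressedEntry w (hessKer (AN R j) (VN R P j) (WN R P j)) y a b = dressedEntry (wStep Lc (j + 1)) (hessKer (AN R j) (VN R P j) (WN R P j)) y a b :=
  dressedEntry_eq_of_dualGauge_of_wardTransversal w (wStep Lc (j + 1)) (hessKer (AN R j) (VN R P j) (WN R P j)) hw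
    (fun κ l => absMoment₂_wStep (Lc := Lc) (j + 1) κ l) (fun c e => absMoment₂_hessKer_AN R P j c e) hgaugeD hW𝒯
    (indexSymmetric_hessKer_AN R P j) y a b

/-- [folklore] **`htr_of_dualGauge_of_ward` — THE END CONSUMER's TRANSPORT ROW UNDER (3a), DUAL GAUGE LETTER.**  For a storey-indexed weight family `w` and ANY left sides `H j`
satisfying the true-weight transport row `hHw` (the END: road `TowerFTransportRowW.htr_rec_w` at `w`), the storey-indexed dual gauge letters `hgaugeᴰ j` and Ward letters `hW𝒯 j`
(`j ≥ 1`) give the consumer's `htr`: `∀ j ≥ 1, H j μ ν z = Lc^8 · dressedEntry (wStep Lc (j+1)) (hessKer (AN R j) (VN R P j) (WN R P j)) ((Lc:ℤ)•z) μ ν`. -/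
theorem htr_of_dualGauge_of_ward (w : ℕ → EKer 4) (hw : ∀ j κ l, AbsMoment₂ (w j κ l))
    (hgaugeD : ∀ j : ℕ, 1 ≤ j → ∀ (a : Fin 4) (ψ : Form1 4 ℝ) (M : ℝ), (∀ c x, |ψ c x| ≤ M) → codiff₁ ψ = 0 →
      lip1 ψ (fun c x => w j c a (-x) - wStep Lc (j + 1) c a (-x)) = 0)
    (hW𝒯 : ∀ j : ℕ, 1 ≤ j → WardTransversal (flipK (hessKer (AN R j) (VN R P j) (WN R P j))))
    (H : ℕ → Fin 4 → Fin 4 → (Fin 4 → ℤ) → ℝ)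
    (hHw : ∀ j : ℕ, 1 ≤ j → ∀ (μ ν : Fin 4) (z : Fin 4 → ℤ),
      H j μ ν z = (Lc : ℝ) ^ 8 * dressedEntry (w j) (hessKer (AN R j) (VN R P j) (WN R P j)) ((Lc : ℤ) • z) μ ν) :
    ∀ j : ℕ, 1 ≤ j → ∀ (μ ν : Fin 4) (z : Fin 4 → ℤ),
      H j μ ν z = (Lc : ℝ) ^ 8 * dressedEntry (wStep Lc (j + 1)) (hessKer (AN R j) (VN R P j) (WN R P j)) ((Lc : ℤ) • z) μ ν := by
  intro j hj μ ν z
  rw [hHw j hj μ ν z, dressedEntry_hessKer_AN_eq_of_dualGauge_of_ward R P j (w j) (hw j) (hgaugeD j hj) (hW𝒯 j hj) ((Lc : ℤ) • z) μ ν]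

end Transport

/-! ## §2 Storey `0` (the anchor): `hWT 0` and the consumer's `hF₁` text from `hgaugeᴰ 0` alone -/

section Anchor

variable {Lc : ℕ} [NeZero Lc]

/-- [folklore] **`hWT_anchor_of_dualGauge` — THE END's STOREY-0 DRESSING-INVARIANCE JUNCTION FROM THE DUAL GAUGE LETTER ALONE** (both table letters of the anchor are tree theorems,
road g62 `TowerFAnchorWardRecord` §1, FINDING FP-70 (b)): `dressedEntry wF₀ (TshotOf … 1) ((Lc:ℤ)•z) μ ν = dressedEntry (wStep Lc 1) (TshotOf … 1) ((Lc:ℤ)•z) μ ν`. -/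
theorem hWT_anchor_of_dualGauge (hLc : Odd Lc) (hL2 : 2 ≤ Lc) {N : ℕ} (hN : 2 ≤ N) (cΛ cB : ℝ)
    (hΛ : cΛ * (Lc : ℝ) ^ 4 = 2) (hcB : cB = -((Lc : ℝ) ^ 12 / 4)) (Rt : Roots Lc) (P : Pins)
    (wF₀ : EKer 4) (hwF : ∀ κ l, AbsMoment₂ (wF₀ κ l))
    (hgaugeD₀ : ∀ (a : Fin 4) (ψ : Form1 4 ℝ) (M : ℝ), (∀ c x, |ψ c x| ≤ M) → codiff₁ ψ = 0 →
      lip1 ψ (fun c x => wF₀ c a (-x) - wStep Lc 1 c a (-x)) = 0) :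
    ∀ (μ ν : Fin 4) (z : Fin 4 → ℤ),
      dressedEntry wF₀ (TshotOf Lc (JcComp hLc N cΛ cB Rt P) 1) ((Lc : ℤ) • z) μ ν
        = dressedEntry (wStep Lc 1) (TshotOf Lc (JcComp hLc N cΛ cB Rt P) 1) ((Lc : ℤ) • z) μ ν :=
  fun μ ν z => dressedEntry_eq_of_dualGauge_of_wardTransversal wF₀ (wStep Lc 1) (TshotOf Lc (JcComp hLc N cΛ cB Rt P) 1) hwF
    (fun κ l => absMoment₂_wStep (Lc := Lc) 1 κ l) (absMoment₂_TshotOf_JcComp_one hLc N cΛ cB Rt P) hgaugeD₀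
    (wardTransversal_flipK_TshotOf_JcComp_one hLc hL2 hN cΛ cB hΛ hcB Rt P) (indexSymmetric_TshotOf_JcComp_one hLc N cΛ cB Rt P) ((Lc : ℤ) • z) μ ν

/-- [folklore] **`hF₁_of_anchor_of_dualGauge` — THE END CONSUMER's ANCHOR ROW `hF₁` UNDER (3a), DUAL GAUGE LETTER**: if `H μ ν z = Lc^8 · dressedEntry wF₀ (TshotOf … 1) ((Lc:ℤ)•z) μ ν`
(the END: road `TowerFAnchorRowW.hF₁_rec_w` at `w 0 := wF₀`) and `hgaugeᴰ₀` holds, then `H μ ν z = Lc^8 · dressedEntry (wStep Lc 1) (TshotOf Lc (JcComp …) 1) ((Lc:ℤ)•z) μ ν`. -/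
theorem hF₁_of_anchor_of_dualGauge (hLc : Odd Lc) (hL2 : 2 ≤ Lc) {N : ℕ} (hN : 2 ≤ N) (cΛ cB : ℝ)
    (hΛ : cΛ * (Lc : ℝ) ^ 4 = 2) (hcB : cB = -((Lc : ℝ) ^ 12 / 4)) (Rt : Roots Lc) (P : Pins)
    (wF₀ : EKer 4) (hwF : ∀ κ l, AbsMoment₂ (wF₀ κ l))
    (hgaugeD₀ : ∀ (a : Fin 4) (ψ : Form1 4 ℝ) (M : ℝ), (∀ c x, |ψ c x| ≤ M) → codiff₁ ψ = 0 →
      lip1 ψ (fun c x => wF₀ c a (-x) - wStep Lc 1 c a (-x)) = 0)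
    (H : Fin 4 → Fin 4 → (Fin 4 → ℤ) → ℝ)
    (hF₁w : ∀ (μ ν : Fin 4) (z : Fin 4 → ℤ),
      H μ ν z = (Lc : ℝ) ^ 8 * dressedEntry wF₀ (TshotOf Lc (JcComp hLc N cΛ cB Rt P) 1) ((Lc : ℤ) • z) μ ν) :
    ∀ (μ ν : Fin 4) (z : Fin 4 → ℤ),
      H μ ν z = (Lc : ℝ) ^ 8 * dressedEntry (wStep Lc 1) (TshotOf Lc (JcComp hLc N cΛ cB Rt P) 1) ((Lc : ℤ) • z) μ ν := by
  intro μ ν z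
  rw [hF₁w μ ν z, hWT_anchor_of_dualGauge hLc hL2 hN cΛ cB hΛ hcB Rt P wF₀ hwF hgaugeD₀ μ ν z]

end Anchor

/-! ## §3 The END consumer's two F-rows at the renormalised true weight, dual letters -/

section TrueWeight

variable (Lc : ℕ) [NeZero Lc] (hLc : Odd Lc) (N : ℕ) (cΛ cB : ℝ) (Pn : Pins) (uF : ℕ → ℝ)
  (Q : StepRows 3 Lc) (ℓ : Fin (3 + 1) → Site (3 + 1) → Bond (3 + 1) → ℝ) (sn α : ℕ → ℝ) {Bℓ : ℝ}

/-- [folklore] **`htr_trueWeight_dual` — THE END CONSUMER's `htr` UNDER (3a), DUAL LETTERS.**  At the renormalised true weight `w j := fun c μ p => (α j)⁻¹ * wF Lc Q ℓ sn j c μ p` the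
σ′-scaled dressed F-families satisfy `…PairingSummable`'s `htr` TEXT, given the dual gauge letters `hgaugeᴰ j` and the Ward letters `hW𝒯 j` (j ≥ 1) ONLY — road g61 `htr_rec_w` (with
`hwloc := hwloc_mul_wF`) composed with §1 `htr_of_dualGauge_of_ward` (weight moments PART 97 `absMoment₂_mul_wF`).  Conclusion VERBATIM g62 `TowerFRowsTrueWeight.htr_trueWeight`'s. -/
theorem htr_trueWeight_dual (hB : 0 ≤ Bℓ) (hℓb : ∀ (μ : Fin (3 + 1)) (y : Site (3 + 1)) (f : Bond (3 + 1)), |ℓ μ y f| ≤ Bℓ) (huF : ∀ j, uF j ≠ 0)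
    (hgaugeD : ∀ j : ℕ, 1 ≤ j → ∀ (a : Fin 4) (ψ : Form1 4 ℝ) (M : ℝ), (∀ c x, |ψ c x| ≤ M) → codiff₁ ψ = 0 →
      lip1 ψ (fun c x => (α j)⁻¹ * wF Lc Q ℓ sn j c a (-x) - wStep Lc (j + 1) c a (-x)) = 0)
    (hW𝒯 : ∀ j : ℕ, 1 ≤ j → WardTransversal (flipK (hessKer (AN (Roots.ctr Lc) j) (VN (Roots.ctr Lc) Pn j) (WN (Roots.ctr Lc) Pn j)))) :
    ∀ j : ℕ, 1 ≤ j → ∀ (μ ν : Fin 4) (z : Fin 4 → ℤ),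
      hessKer (scaleK (Sum.elim (fun _ : Fin (3 + 1) => (1 : ℝ)) (fun _ : Fin (3 + 1) => (uF j)⁻¹)) (Sum.elim (fun _ : Fin (3 + 1) => (1 : ℝ)) (fun _ : Fin (3 + 1) => (uF j)⁻¹)) (AN (Roots.ctr Lc) j)) (fun μ y => scaleK (Sum.elim (fun _ : Fin (3 + 1) => (1 : ℝ)) (fun _ : Fin (3 + 1) => (uF j))) (Sum.elim (fun _ : Fin (3 + 1) => (1 : ℝ)) (fun _ : Fin (3 + 1) => (uF j))) ((Lc : ℝ) ^ 4 • dressV (Lc ^ (j + 1)) Lc ((fun (k : ℕ) (c μ : Fin (3 + 1)) (p : Fin (3 + 1) → ℤ) => (α k)⁻¹ * wF Lc Q ℓ sn k c μ p) j) (VN (Roots.ctr Lc) Pn j) μ y)) (fun μ y ν y' => scaleK (Sum.elim (fun _ : Fin (3 + 1) => (1 : ℝ)) (fun _ : Fin (3 + 1) => (uF j))) (Sum.elim (fun _ : Fin (3 + 1) => (1 : ℝ)) (fun _ : Fin (3 + 1) => (uF j))) ((Lc : ℝ) ^ 8 • dressW (Lc ^ (j + 1)) Lc ((fun (k : ℕ)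 (c μ : Fin (3 + 1)) (p : Fin (3 + 1) → ℤ) => (α k)⁻¹ * wF Lc Q ℓ sn k c μ p) j) (WN (Roots.ctr Lc) Pn j) μ y ν y')) μ ν z
        = (Lc : ℝ) ^ 8 * dressedEntry (wStep Lc (j + 1)) (hessKer (AN (Roots.ctr Lc) j) (VN (Roots.ctr Lc) Pn j) (WN (Roots.ctr Lc) Pn j)) ((Lc : ℤ) • z) μ ν :=
  htr_of_dualGauge_of_ward (Roots.ctr Lc) Pn (fun (k : ℕ) (c μ : Fin (3 + 1)) (p : Fin (3 + 1) → ℤ) => (α k)⁻¹ * wF Lc Q ℓ sn k c μ p)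
    (fun j κ l => absMoment₂_mul_wF Lc Q sn hB hℓb ((α j)⁻¹) j κ l) hgaugeD hW𝒯
    (fun j μ ν z => hessKer (scaleK (Sum.elim (fun _ : Fin (3 + 1) => (1 : ℝ)) (fun _ : Fin (3 + 1) => (uF j)⁻¹)) (Sum.elim (fun _ : Fin (3 + 1) => (1 : ℝ)) (fun _ : Fin (3 + 1) => (uF j)⁻¹)) (AN (Roots.ctr Lc) j)) (fun μ y => scaleK (Sum.elim (fun _ : Fin (3 + 1) => (1 : ℝ)) (fun _ : Fin (3 + 1) => (uF j))) (Sum.elim (fun _ : Fin (3 + 1) => (1 : ℝ)) (fun _ : Fin (3 + 1) => (uF j))) ((Lc : ℝ) ^ 4 • dressV (Lc ^ (j + 1)) Lc ((fun (k : ℕ) (c μ : Fin (3 + 1)) (p : Fin (3 + 1) → ℤ) => (α k)⁻¹ * wF Lc Q ℓ sn k c μ p) j) (VN (Roots.ctr Lc) Pn j) μ y)) (fun μ y ν y' => scaleK (Sum.elim (fun _ : Fin (3 + 1) => (1 : ℝ)) (fun _ : Fin (3 + 1) => (uF j))) (Sum.elim (fun _ : Fin (3 + 1) => (1 : ℝ))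 (fun _ : Fin (3 + 1) => (uF j))) ((Lc : ℝ) ^ 8 • dressW (Lc ^ (j + 1)) Lc ((fun (k : ℕ) (c μ : Fin (3 + 1)) (p : Fin (3 + 1) → ℤ) => (α k)⁻¹ * wF Lc Q ℓ sn k c μ p) j) (WN (Roots.ctr Lc) Pn j) μ y ν y')) μ ν z)
    (fun j hj μ ν z => htr_rec_w Lc Pn uF (fun (k : ℕ) (c μ : Fin (3 + 1)) (p : Fin (3 + 1) → ℤ) => (α k)⁻¹ * wF Lc Q ℓ sn k c μ p) (hwloc_mul_wF Lc Q ℓ sn hB hℓb (fun k : ℕ => (α k)⁻¹)) huF j hj μ ν z)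

/-- [folklore] **`hF₁_trueWeight_dual` — THE END CONSUMER's `hF₁` UNDER (3a), DUAL LETTERS.**  At `w 0` the σ′₀-scaled dressed LITERAL pair satisfies `…PairingSummable`'s `hF₁` TEXT
given `hgaugeᴰ 0` and M‴'s scalars only (the anchor table's Ward identity and index symmetry are tree theorems) — road g61 `hF₁_rec_w` composed with §2 `hF₁_of_anchor_of_dualGauge`.
Conclusion VERBATIM g62 `TowerFRowsTrueWeight.hF₁_trueWeight`'s. -/
theorem hF₁_trueWeight_dual (hL2 : 2 ≤ Lc) (hN : 2 ≤ N) (hΛ : cΛ * (Lc : ℝ) ^ 4 = 2) (hcB : cB = -((Lc : ℝ) ^ 12 / 4))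
    (hB : 0 ≤ Bℓ) (hℓb : ∀ (μ : Fin (3 + 1)) (y : Site (3 + 1)) (f : Bond (3 + 1)), |ℓ μ y f| ≤ Bℓ) (huF : uF 0 ≠ 0)
    (hgaugeD₀ : ∀ (a : Fin 4) (ψ : Form1 4 ℝ) (M : ℝ), (∀ c x, |ψ c x| ≤ M) → codiff₁ ψ = 0 →
      lip1 ψ (fun c x => (α 0)⁻¹ * wF Lc Q ℓ sn 0 c a (-x) - wStep Lc 1 c a (-x)) = 0) :
    ∀ (μ ν : Fin 4) (z : Fin 4 → ℤ),
      hessKer (scaleK (Sum.elim (fun _ : Fin (3 + 1) => (1 : ℝ)) (fun _ : Fin (3 + 1) => (uF 0)⁻¹)) (Sum.elim (fun _ : Fin (3 + 1) => (1 : ℝ)) (fun _ : Fin (3 + 1) => (uF 0)⁻¹)) (GcombSh (d := 3) Lc 0)) (fun μ y => scaleK (Sum.elim (fun _ : Fin (3 + 1) => (1 : ℝ)) (fun _ : Fin (3 + 1) => (uF 0))) (Sum.elim (fun _ : Fin (3 + 1) => (1 : ℝ)) (fun _ : Fin (3 + 1) => (uF 0))) ((Lc : ℝ) ^ 4 • dressV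 Lc Lc ((fun (k : ℕ) (c μ : Fin (3 + 1)) (p : Fin (3 + 1) → ℤ) => (α k)⁻¹ * wF Lc Q ℓ sn k c μ p) 0) (vertexOfK (GcombSh (d := 3) Lc 0) Lc (JsB12CombSh0 hLc N (symTablesAn1S2 3 Lc cΛ) cΛ cB 0).S) μ y)) (fun μ y ν y' => scaleK (Sum.elim (fun _ : Fin (3 + 1) => (1 : ℝ)) (fun _ : Fin (3 + 1) => (uF 0))) (Sum.elim (fun _ : Fin (3 + 1) => (1 : ℝ)) (fun _ : Fin (3 + 1) => (uF 0))) ((Lc : ℝ) ^ 8 • dressW Lc Lc ((fun (k : ℕ) (c μ : Fin (3 + 1)) (p : Fin (3 + 1) → ℤ) => (α k)⁻¹ * wF Lc Q ℓ sn k c μ p) 0) (JsB12CombSh0 hLc N (symTablesAn1S2 3 Lc cΛ) cΛ cB 0).W μ y ν y')) μ ν z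
        = (Lc : ℝ) ^ 8 * dressedEntry (wStep Lc 1) (TshotOf Lc (JcComp hLc N cΛ cB (Roots.ctr Lc) Pn) 1) ((Lc : ℤ) • z) μ ν :=
  hF₁_of_anchor_of_dualGauge hLc hL2 hN cΛ cB hΛ hcB (Roots.ctr Lc) Pn ((fun (k : ℕ) (c μ : Fin (3 + 1)) (p : Fin (3 + 1) → ℤ) => (α k)⁻¹ * wF Lc Q ℓ sn k c μ p) 0)
    (fun κ l => absMoment₂_mul_wF Lc Q sn hB hℓb ((α 0)⁻¹) 0 κ l) hgaugeD₀
    (fun μ ν z => hessKer (scaleK (Sum.elim (fun _ : Fin (3 + 1) => (1 : ℝ)) (fun _ : Fin (3 + 1) => (uF 0)⁻¹)) (Sum.elim (fun _ : Fin (3 + 1) => (1 : ℝ)) (fun _ : Fin (3 + 1) => (uF 0)⁻¹)) (GcombSh (d := 3) Lc 0)) (fun μ y => scaleK (Sum.elim (fun _ : Fin (3 + 1) => (1 : ℝ)) (fun _ : Fin (3 + 1) => (uF 0))) (Sum.elim (fun _ : Fin (3 + 1) => (1 : ℝ)) (fun _ : Fin (3 + 1) => (uF 0))) ((Lc : ℝ)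 ^ 4 • dressV Lc Lc ((fun (k : ℕ) (c μ : Fin (3 + 1)) (p : Fin (3 + 1) → ℤ) => (α k)⁻¹ * wF Lc Q ℓ sn k c μ p) 0) (vertexOfK (GcombSh (d := 3) Lc 0) Lc (JsB12CombSh0 hLc N (symTablesAn1S2 3 Lc cΛ) cΛ cB 0).S) μ y)) (fun μ y ν y' => scaleK (Sum.elim (fun _ : Fin (3 + 1) => (1 : ℝ)) (fun _ : Fin (3 + 1) => (uF 0))) (Sum.elim (fun _ : Fin (3 + 1) => (1 : ℝ)) (fun _ : Fin (3 + 1) => (uF 0))) ((Lc : ℝ) ^ 8 • dressW Lc Lc ((fun (k : ℕ) (c μ : Fin (3 + 1)) (p : Fin (3 + 1) → ℤ) => (α k)⁻¹ * wF Lc Q ℓ sn k c μ p) 0) (JsB12CombSh0 hLc N (symTablesAn1S2 3 Lc cΛ) cΛ cB 0).W μ y ν y')) μ ν z)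
    (fun μ ν z => hF₁_rec_w Lc hLc N cΛ cB Pn uF (fun (k : ℕ) (c μ : Fin (3 + 1)) (p : Fin (3 + 1) → ℤ) => (α k)⁻¹ * wF Lc Q ℓ sn k c μ p) (hwloc_mul_wF Lc Q ℓ sn hB hℓb (fun k : ℕ => (α k)⁻¹)) huF μ ν z)

end TrueWeight

end Summit.QuantumFields.BalabanUV.Beta.FP.TowerFRowsTrueWeightDual

end
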